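/-
Copyright: the b2b-balaban T⁴-continuum CRUX team, row NE7b leaf lineage `t4-ne7b-formalise-leaf-03` (gen 142). Project licence.
-/
import Literature.Analysis.Convex.Subgradient
import Mathlib.Analysis.Convex.Strong
import Mathlib.Analysis.Calculus.Gradient.Basic
import Mathlib.Analysis.InnerProductSpace.Calculus

/-!
# THE LETTER (ℓ1) IN FIRST-ORDER CURRENCY WITHOUT DIFFERENTIABILITY: a strongly convex function on an OPEN convex window carries a
# vector field `dV` with `V x + ⟪dV x, y − x⟫ + (m∕2)‖y − x‖² ≤ V y` on the window — a strong SUBGRADIENT field — and `dV x = ∇V x`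
# wherever `V` is differentiable (row NE7b, node U5c; residual (R2′) family (2), letter (ℓ1) «`λ` ON `K`»; kernel lemmas of convex analysis)

Cell `pub-balaban`, sub-cell `t4`, spine estimate NE7b (`T4WeightBudget.RelWeightBound`; the cell's OWN estimate — NOT PRINTED in
[Bałaban 1983–89], NOT PROVED).  Crux-route work under `Spine/NE7b/` by a row leaf on the convexity road; NOTHING of Bałaban's is named
or asserted; no `T4Continuum/Support` leaf typed; no `def`; zero `sorry`.  Imports: the tree's `Literature.Analysis.Convex.Subgradient`
(Hiriart-Urruty–Lemaréchal 2001, Chap. D: existence of subgradients on open convex sets; uniqueness at points of differentiability) and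
Mathlib only — independent of the farm's olean frontier.

WHY.  The OWNER's `…LogConcaveMarginal` §3 delivers the convexity modulus of a windowed marginal `V⁺(x) = −log ∫_{K_x} e^{−V(x,·)}` for a
GENERAL convex joint window `K` — fibres moving with the base point allowed — but in SECANT currency (`StrongConvexOn B λ V⁺`).  The way
back to the sockets' FIRST-ORDER currency typed so far needs a derivative: `…LogConcaveMarginal` §5 (`HasFDerivAt`),
`…StrongConvexFirstOrderWithin` (`HasFDerivWithinAt`), with the derivative SUPPLIED only for PRODUCT windows (`…LogConcaveMarginalDeriv`,
`…FibreWindowSmooth`).  For a joint window `V⁺` need not be `C¹` (`V = 0`, `K` a triangle: `−log` of a piecewise-linear fibre length).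
THIS FILE records what survives with NO differentiability at all: on an OPEN convex window of a finite-dimensional (or complete, given
continuity) real inner product space, strong convexity alone yields a vector field `dV` obeying the road's letter in the «ANY vector
field» currency of `…LogConcaveMarginal.secant_of_firstOrderOn` and `…ConvexityModulusTransport` §2 — a strong subgradient field — and
that field necessarily coincides with the gradient at every point where `V` is differentiable.

WHAT IS PROVED ([folklore]; Hiriart-Urruty–Lemaréchal 2001, Chap. D, Thm 1.2.2 ∕ Cor. 2.1.4 — via the tree's `Literature.Analysis.Convex`):
* §1 **`exists_strongSubgradient_of_strongConvexOn`** — `[FiniteDimensional ℝ E]`, `StrongConvexOn B m V`, `IsOpen B`, `x ∈ B` ⊢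
  `∃ p, ∀ y ∈ B, V x + ⟪p, y − x⟫ + (m∕2)‖y − x‖² ≤ V y` (a subgradient `q` of the convex `V − (m∕2)‖·‖²`, `p := q + m • x`);
  **`exists_strongSubgradient_of_strongConvexOn_of_continuousOn`** — `[CompleteSpace E]` and `ContinuousOn V B` instead of finite dimension.
* §2 **`exists_firstOrderOn_field_of_strongConvexOn`** (and `…_of_continuousOn`) — ⊢ `∃ dV : E → E, ∀ x ∈ B, ∀ y ∈ B,
  V x + ⟪dV x, y − x⟫ + (m∕2)‖y − x‖² ≤ V y`.
* §3 **`eq_gradient_of_strongSubgradient`** — `B ∈ 𝓝 x`, the strong letter at `x` with vector `p`, `DifferentiableAt ℝ V x` ⊢ `p = gradient V x`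
  (ANY sign of `m`: `p` is a plain subgradient at `x` of the RE-CENTRED `y ↦ V y − (m∕2)‖y − x‖²`, whose derivative at `x` is `V`'s).
* §4 a non-vacuity `example` (`V = ½‖x‖²`, `m = 1`, `B = univ`).
* §5 (v2, appended) THE FORM CURRENCY (refuter κ-ne7bref-g78-1 (b); the converse of `…ConvexityModulusTransport.secant_of_firstOrderOn_form`
  for QUADRATIC forms): for `Q : E → ℝ` with an exact first-order expansion `Q y = Q x + ⟪dQ x, y − x⟫ + Q (y − x)` (every continuous
  quadratic form; `(m∕2)‖·‖²` with `dQ x = m • x`): **`exists_firstOrderOn_formField_of_convexOn_sub`** (`ConvexOn ℝ B (V − Q)` on an open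
  finite-dimensional window ⊢ `∃ dV, ∀ x ∈ B, ∀ y ∈ B, V x + ⟪dV x, y − x⟫ + Q (y − x) ≤ V y`); `convexOn_sub_of_secantForm` (the secant
  letter `V(a p + b q) + a b Q(q − p) ≤ a V p + b V q` with `Q` also 2-homogeneous ⊢ `ConvexOn ℝ B (V − Q)`); the composite
  **`exists_firstOrderOn_formField_of_secantForm`**; `eq_gradient_of_formSubgradient` (the field is `∇V` at interior points of
  differentiability, given `HasGradientAt Q (dQ x) x`).

NOT HERE (honest): which of print's windows are products or joint, in which chart ((A3) ∕ (A1c) readings — programme-sized, NC-NE7b-α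
UNRULED); whether an END socket can consume field currency (the sockets typed so far use honest gradients); almost-everywhere
differentiability of convex functions (Rademacher ∕ the tree's `AlexandrovTheorem` — not used); anything of Bałaban's.  NE7b NOT PRINTED ∕
NOT PROVED; spine PROVED 0∕9; rung (B)+1 on a FINITE torus — NOT infinite volume, NOT the mass gap, NOT Clay.
HONEST DEPENDENCY: continuum YM on T⁴ ⇐ BetaPertH ∧ nine spine estimates (0/9 proved); BetaPertH ⇐ (D1) ∧ (D4) ∧ CAP+tail; G-an2-4
gates asym, D1 and NE2/3/4.
-/

set_option autoImplicit false

noncomputable section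

open Set Filter Topology InnerProductSpace
open scoped RealInnerProductSpace
open Literature.Analysis.Convex

namespace Summit.QuantumFields.BalabanUV.T4Continuum.NE7b.StrongConvexSubgradientField

variable {E : Type*} [NormedAddCommGroup E] [InnerProductSpace ℝ E] {B : Set E} {m : ℝ} {V : E → ℝ} {x : E}

/-! ## §1 Strong subgradients exist at every point of an open window -/

/-- The algebra of the quadratic tilt: `(m∕2)‖y‖² − (m∕2)‖x‖² − m⟪x, y − x⟫ = (m∕2)‖y − x‖²`. [folklore] -/
theorem half_mul_norm_sq_sub_sub_inner (m : ℝ) (x y : E) :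
    m / 2 * ‖y‖ ^ 2 - m / 2 * ‖x‖ ^ 2 - m * ⟪x, y - x⟫ = m / 2 * ‖y - x‖ ^ 2 := by
  rw [inner_sub_right, real_inner_self_eq_norm_sq, norm_sub_sq_real, real_inner_comm]
  ring

/-- From a plain subgradient `q` of `y ↦ V y − (m∕2)‖y‖²` at `x` within `B` to a STRONG subgradient of `V`: with `p := q + m • x`,
`V x + ⟪p, y − x⟫ + (m∕2)‖y − x‖² ≤ V y` on `B`. [folklore] -/
theorem strongSubgradient_of_hasSubgradientWithinAt {q : E}
    (hq : HasSubgradientWithinAt (fun y => V y - m / (2 : ℝ) * ‖y‖ ^ 2) B q x) :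
    ∀ y ∈ B, V x + ⟪q + m • x, y - x⟫ + m / 2 * ‖y - x‖ ^ 2 ≤ V y := by
  intro y hy
  have h := hq y hy
  simp only at h
  rw [inner_add_left, real_inner_smul_left, ← half_mul_norm_sq_sub_sub_inner m x y]
  linarith

/-- **STRONG SUBGRADIENTS EXIST ON AN OPEN WINDOW (finite dimension)**: `StrongConvexOn B m V`, `B` open, `x ∈ B` ⊢
`∃ p, ∀ y ∈ B, V x + ⟪p, y − x⟫ + (m∕2)‖y − x‖² ≤ V y`.  (Mathlib's `strongConvexOn_iff_convex` makes `V − (m∕2)‖·‖²` convex on `B`; the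
tree's `ConvexOn.exists_hasSubgradientWithinAt_of_finiteDimensional` gives it a subgradient; tilt back.)  Hiriart-Urruty–Lemaréchal 2001,
Chap. D, Thm 1.2.2. [folklore] -/
theorem exists_strongSubgradient_of_strongConvexOn [FiniteDimensional ℝ E] (hV : StrongConvexOn B m V) (hB : IsOpen B)
    (hx : x ∈ B) : ∃ p : E, ∀ y ∈ B, V x + ⟪p, y - x⟫ + m / 2 * ‖y - x‖ ^ 2 ≤ V y := by
  obtain ⟨q, hq⟩ := ConvexOn.exists_hasSubgradientWithinAt_of_finiteDimensional (strongConvexOn_iff_convex.1 hV) hB hx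
  exact ⟨q + m • x, strongSubgradient_of_hasSubgradientWithinAt hq⟩

/-- **STRONG SUBGRADIENTS EXIST ON AN OPEN WINDOW (complete space, `V` continuous on `B`)** — the Hahn–Banach form.
Hiriart-Urruty–Lemaréchal 2001, Chap. D, Thm 1.2.2. [folklore] -/
theorem exists_strongSubgradient_of_strongConvexOn_of_continuousOn [CompleteSpace E] (hV : StrongConvexOn B m V)
    (hB : IsOpen B) (hc : ContinuousOn V B) (hx : x ∈ B) :
    ∃ p : E, ∀ y ∈ B, V x + ⟪p, y - x⟫ + m / 2 * ‖y - x‖ ^ 2 ≤ V y := by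
  have hc' : ContinuousOn (fun y => V y - m / (2 : ℝ) * ‖y‖ ^ 2) B :=
    hc.sub ((continuous_const.mul (continuous_norm.pow 2)).continuousOn)
  obtain ⟨q, hq⟩ := ConvexOn.exists_hasSubgradientWithinAt (strongConvexOn_iff_convex.1 hV) hB hc' hx
  exact ⟨q + m • x, strongSubgradient_of_hasSubgradientWithinAt hq⟩

/-! ## §2 The road's letter with a (subgradient) vector field — no differentiability -/

/-- **THE ROAD'S FIRST-ORDER LETTER WITH A FIELD, FROM STRONG CONVEXITY ALONE (finite dimension)**: `StrongConvexOn B m V` on an open `B`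
⊢ `∃ dV : E → E, ∀ x ∈ B, ∀ y ∈ B, V x + ⟪dV x, y − x⟫ + (m∕2)‖y − x‖² ≤ V y` — the «any vector field» currency of
`…LogConcaveMarginal.secant_of_firstOrderOn` ∕ `…ConvexityModulusTransport` §2.  (Choice over §1; off `B` the field is unspecified.)
[folklore] -/
theorem exists_firstOrderOn_field_of_strongConvexOn [FiniteDimensional ℝ E] (hV : StrongConvexOn B m V) (hB : IsOpen B) :
    ∃ dV : E → E, ∀ x ∈ B, ∀ y ∈ B, V x + ⟪dV x, y - x⟫ + m / 2 * ‖y - x‖ ^ 2 ≤ V y := by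
  classical
  refine ⟨fun x => if hx : x ∈ B then Classical.choose (exists_strongSubgradient_of_strongConvexOn hV hB hx) else 0,
    fun x hx y hy => ?_⟩
  simp only [dif_pos hx]
  exact Classical.choose_spec (exists_strongSubgradient_of_strongConvexOn hV hB hx) y hy

/-- The same on a complete space with `V` continuous on `B`. [folklore] -/
theorem exists_firstOrderOn_field_of_strongConvexOn_of_continuousOn [CompleteSpace E] (hV : StrongConvexOn B m V)
    (hB : IsOpen B) (hc : ContinuousOn V B) :
    ∃ dV : E → E, ∀ x ∈ B, ∀ y ∈ B, V x + ⟪dV x, y - x⟫ + m / 2 * ‖y - x‖ ^ 2 ≤ V y := by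
  classical
  refine ⟨fun x => if hx : x ∈ B then
      Classical.choose (exists_strongSubgradient_of_strongConvexOn_of_continuousOn hV hB hc hx) else 0,
    fun x hx y hy => ?_⟩
  simp only [dif_pos hx]
  exact Classical.choose_spec (exists_strongSubgradient_of_strongConvexOn_of_continuousOn hV hB hc hx) y hy

/-! ## §3 The field is the gradient wherever `V` is differentiable -/

/-- **A STRONG SUBGRADIENT AT AN INTERIOR POINT OF DIFFERENTIABILITY IS THE GRADIENT** (any sign of `m`): if `B ∈ 𝓝 x`,
`V x + ⟪p, y − x⟫ + (m∕2)‖y − x‖² ≤ V y` for `y ∈ B`, and `V` is differentiable at `x`, then `p = gradient V x`.  (`p` is a plain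
subgradient at `x` of the re-centred `y ↦ V y − (m∕2)‖y − x‖²`, whose Fréchet derivative at `x` is that of `V`; uniqueness of the
subgradient at interior points of differentiability — the tree's `HasSubgradientWithinAt.inner_eq_of_hasFDerivAt`.)
Hiriart-Urruty–Lemaréchal 2001, Chap. D, Cor. 2.1.4. [folklore] -/
theorem eq_gradient_of_strongSubgradient [CompleteSpace E] {p : E} (hBx : B ∈ 𝓝 x)
    (hp : ∀ y ∈ B, V x + ⟪p, y - x⟫ + m / 2 * ‖y - x‖ ^ 2 ≤ V y) (hd : DifferentiableAt ℝ V x) : p = gradient V x := by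
  -- `p` is a subgradient of the re-centred function
  have hsub : HasSubgradientWithinAt (fun y => V y - m / 2 * ‖y - x‖ ^ 2) B p x := by
    intro y hy
    have h := hp y hy
    simp only [sub_self, norm_zero]
    linarith [h]
  -- its derivative at `x` is `V`'s
  have hq : HasFDerivAt (fun y => m / 2 * ‖y - x‖ ^ 2) (0 : E →L[ℝ] ℝ) x := by
    have h1 : HasFDerivAt (fun y : E => ‖y - x‖ ^ 2) (0 : E →L[ℝ] ℝ) x := by
      have h := ((hasFDerivAt_id x).sub_const x).norm_sq
      simpa using h
    simpa using h1.const_mul (m / 2)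
  have hder : HasFDerivAt (fun y => V y - m / 2 * ‖y - x‖ ^ 2) (fderiv ℝ V x) x := by
    simpa [Pi.sub_def] using hd.hasFDerivAt.sub hq
  -- uniqueness of the subgradient at an interior point of differentiability
  have hinner : ∀ v, ⟪p, v⟫ = fderiv ℝ V x v := fun v => hsub.inner_eq_of_hasFDerivAt hBx hder v
  refine ext_inner_right ℝ fun v => ?_
  rw [hinner v, gradient, toDual_symm_apply]

/-- Corollary: on an open `B`, a field `dV` obeying the strong letter agrees with `gradient V` at every point of `B` where `V` is
differentiable. [folklore] -/
theorem field_eq_gradient_of_differentiableAt [CompleteSpace E] (hB : IsOpen B) {dV : E → E}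
    (h : ∀ x ∈ B, ∀ y ∈ B, V x + ⟪dV x, y - x⟫ + m / 2 * ‖y - x‖ ^ 2 ≤ V y) (hx : x ∈ B) (hd : DifferentiableAt ℝ V x) :
    dV x = gradient V x :=
  eq_gradient_of_strongSubgradient (hB.mem_nhds hx) (h x hx) hd

/-! ## §4 Non-vacuity -/

section Toy

variable {n : ℕ}

/-- Non-vacuity toy: every hypothesis of `exists_firstOrderOn_field_of_strongConvexOn` is jointly inhabited — `V = ½‖x‖²` is
`1`-strongly convex on the open set `univ` of the finite-dimensional `EuclideanSpace ℝ (Fin n)`; the produced field obeys the letter. -/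
example : ∃ dV : EuclideanSpace ℝ (Fin n) → EuclideanSpace ℝ (Fin n), ∀ x ∈ (Set.univ : Set (EuclideanSpace ℝ (Fin n))),
    ∀ y ∈ (Set.univ : Set (EuclideanSpace ℝ (Fin n))),
      (fun z : EuclideanSpace ℝ (Fin n) => 1 / 2 * ‖z‖ ^ 2) x + ⟪dV x, y - x⟫ + 1 / 2 * ‖y - x‖ ^ 2 ≤
        (fun z : EuclideanSpace ℝ (Fin n) => 1 / 2 * ‖z‖ ^ 2) y := by
  have hsc : StrongConvexOn (Set.univ : Set (EuclideanSpace ℝ (Fin n))) 1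
      (fun z : EuclideanSpace ℝ (Fin n) => 1 / 2 * ‖z‖ ^ 2) := by
    rw [strongConvexOn_iff_convex]
    have e : (fun z : EuclideanSpace ℝ (Fin n) => 1 / 2 * ‖z‖ ^ 2 - 1 / (2 : ℝ) * ‖z‖ ^ 2) = fun _ => 0 := by
      funext z; ring
    rw [e]
    exact convexOn_const 0 convex_univ
  exact exists_firstOrderOn_field_of_strongConvexOn hsc isOpen_univ

end Toy

/-! ## §5 (v2, appended) The form currency: secant-with-`Q` ⟹ first-order-with-`Q` for quadratic `Q`, no differentiability of `V` -/

section Form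

variable {Q : E → ℝ} {dQ : E → E}

/-- The scalar modulus is the special case `Q = (m∕2)‖·‖²`, `dQ x = m • x` of the expansion letter used below. [folklore] -/
theorem normSq_expansion (m : ℝ) (x y : E) :
    m / 2 * ‖y‖ ^ 2 = m / 2 * ‖x‖ ^ 2 + ⟪m • x, y - x⟫ + m / 2 * ‖y - x‖ ^ 2 := by
  rw [real_inner_smul_left, ← half_mul_norm_sq_sub_sub_inner m x y]
  ring

/-- **A FORM-SUBGRADIENT FIELD FROM CONVEXITY OF `V − Q`**: if `Q` has the exact first-order expansion
`Q y = Q x + ⟪dQ x, y − x⟫ + Q (y − x)` (every continuous quadratic form does; `(m∕2)‖·‖²` with `dQ x = m • x`, `normSq_expansion`) and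
`V − Q` is convex on an OPEN window `B` of a finite-dimensional real inner product space, then
`∃ dV : E → E, ∀ x ∈ B, ∀ y ∈ B, V x + ⟪dV x, y − x⟫ + Q (y − x) ≤ V y` — the first-order letter in the FORM currency of
`…ConvexityModulusTransport` §3, with a field and no differentiability of `V` (a subgradient `r` of `V − Q`, `dV x := r + dQ x`).
Hiriart-Urruty–Lemaréchal 2001, Chap. D, Thm 1.2.2. [folklore] -/
theorem exists_firstOrderOn_formField_of_convexOn_sub [FiniteDimensional ℝ E] (hB : IsOpen B)
    (hQ : ∀ x y : E, Q y = Q x + ⟪dQ x, y - x⟫ + Q (y - x)) (hVQ : ConvexOn ℝ B (fun x => V x - Q x)) :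
    ∃ dV : E → E, ∀ x ∈ B, ∀ y ∈ B, V x + ⟪dV x, y - x⟫ + Q (y - x) ≤ V y := by
  classical
  have key : ∀ x ∈ B, ∃ p : E, ∀ y ∈ B, V x + ⟪p, y - x⟫ + Q (y - x) ≤ V y := by
    intro x hx
    obtain ⟨r, hr⟩ := ConvexOn.exists_hasSubgradientWithinAt_of_finiteDimensional hVQ hB hx
    refine ⟨r + dQ x, fun y hy => ?_⟩
    have h := hr y hy
    simp only at h
    rw [inner_add_left]
    have e := hQ x y
    linarith
  refine ⟨fun x => if hx : x ∈ B then Classical.choose (key x hx) else 0, fun x hx y hy => ?_⟩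
  simp only [dif_pos hx]
  exact Classical.choose_spec (key x hx) y hy

/-- **SECANT-WITH-`Q` ⟹ `V − Q` CONVEX** for a 2-homogeneous `Q` with the exact expansion: the letter
`V (a p + b q) + a b Q(q − p) ≤ a V p + b V q` on a convex `B` gives `ConvexOn ℝ B (V − Q)` (the two letters on `Q` yield the
«parallelogram» identity `a Q p + b Q q − Q(a p + b q) = a b Q(q − p)` for `a + b = 1`). [folklore] -/
theorem convexOn_sub_of_secantForm (hBc : Convex ℝ B) (hQ : ∀ x y : E, Q y = Q x + ⟪dQ x, y - x⟫ + Q (y - x))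
    (hQ2 : ∀ (t : ℝ) (v : E), Q (t • v) = t ^ 2 * Q v)
    (h : ∀ p ∈ B, ∀ q ∈ B, ∀ a b : ℝ, 0 ≤ a → 0 ≤ b → a + b = 1 → V (a • p + b • q) + a * b * Q (q - p) ≤ a * V p + b * V q) :
    ConvexOn ℝ B (fun x => V x - Q x) := by
  refine ⟨hBc, fun p hp q hq a b ha hb hab => ?_⟩
  have hs := h p hp q hq a b ha hb hab
  have hb' : b = 1 - a := by linarith
  have hpz : p - (a • p + b • q) = b • (p - q) := by
    rw [hb']; simp only [sub_smul, one_smul, smul_sub]; abel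
  have hqz : q - (a • p + b • q) = a • (q - p) := by
    rw [hb']; simp only [sub_smul, one_smul, smul_sub]; abel
  have hQneg : Q (p - q) = Q (q - p) := by
    have h1 := hQ2 (-1) (q - p)
    rw [neg_one_smul, neg_sub] at h1
    rw [h1]; ring
  have hin : ⟪dQ (a • p + b • q), p - q⟫ = -⟪dQ (a • p + b • q), q - p⟫ := by
    rw [← inner_neg_right, neg_sub]
  have e1 := hQ (a • p + b • q) p
  have e2 := hQ (a • p + b • q) q
  rw [hpz, inner_smul_right, hQ2, hQneg, hin] at e1
  rw [hqz, inner_smul_right, hQ2] at e2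
  have hid : a * Q p + b * Q q - Q (a • p + b • q) = a * b * Q (q - p) := by
    rw [e1, e2, hb']; ring
  simp only [smul_eq_mul]
  linarith [hid, hs]

/-- **SECANT-WITH-`Q` ⟹ FIRST-ORDER-WITH-`Q` (A FIELD), for quadratic `Q`, on an open convex finite-dimensional window** — the converse of
`…ConvexityModulusTransport.secant_of_firstOrderOn_form`; no differentiability of `V`. [folklore] -/
theorem exists_firstOrderOn_formField_of_secantForm [FiniteDimensional ℝ E] (hB : IsOpen B) (hBc : Convex ℝ B)
    (hQ : ∀ x y : E, Q y = Q x + ⟪dQ x, y - x⟫ + Q (y - x)) (hQ2 : ∀ (t : ℝ) (v : E), Q (t • v) = t ^ 2 * Q v)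
    (h : ∀ p ∈ B, ∀ q ∈ B, ∀ a b : ℝ, 0 ≤ a → 0 ≤ b → a + b = 1 → V (a • p + b • q) + a * b * Q (q - p) ≤ a * V p + b * V q) :
    ∃ dV : E → E, ∀ x ∈ B, ∀ y ∈ B, V x + ⟪dV x, y - x⟫ + Q (y - x) ≤ V y :=
  exists_firstOrderOn_formField_of_convexOn_sub hB hQ (convexOn_sub_of_secantForm hBc hQ hQ2 h)

/-- **THE FORM FIELD IS THE GRADIENT AT INTERIOR POINTS OF DIFFERENTIABILITY**: if `B ∈ 𝓝 x`,
`V x + ⟪p, y − x⟫ + Q (y − x) ≤ V y` on `B`, `Q 0 = 0` with `HasGradientAt Q 0 0` (every `C¹` 2-homogeneous form), and `V` is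
differentiable at `x`, then `p = gradient V x`. [folklore] -/
theorem eq_gradient_of_formSubgradient [CompleteSpace E] {p : E} (hBx : B ∈ 𝓝 x)
    (hp : ∀ y ∈ B, V x + ⟪p, y - x⟫ + Q (y - x) ≤ V y) (hQ0 : Q 0 = 0) (hQd : HasGradientAt Q 0 0)
    (hd : DifferentiableAt ℝ V x) : p = gradient V x := by
  -- `p` is a subgradient of the re-centred `y ↦ V y − Q (y − x)`
  have hsub : HasSubgradientWithinAt (fun y => V y - Q (y - x)) B p x := by
    intro y hy
    have h := hp y hy
    simp only [sub_self, hQ0]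
    linarith [h]
  have hf : HasFDerivAt (fun y : E => y - x) (ContinuousLinearMap.id ℝ E) x := (hasFDerivAt_id x).sub_const x
  have hg : HasFDerivAt Q (toDual ℝ E 0) ((fun y : E => y - x) x) := by
    simp only [sub_self]
    exact hQd.hasFDerivAt
  have hq : HasFDerivAt (fun y => Q (y - x)) (0 : E →L[ℝ] ℝ) x := by
    have h2 := HasFDerivAt.comp x (f := fun y : E => y - x) hg hf
    simpa [Function.comp_def] using h2
  have hder : HasFDerivAt (fun y => V y - Q (y - x)) (fderiv ℝ V x) x := by
    simpa [Pi.sub_def] using hd.hasFDerivAt.sub hq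
  have hinner : ∀ v, ⟪p, v⟫ = fderiv ℝ V x v := fun v => hsub.inner_eq_of_hasFDerivAt hBx hder v
  refine ext_inner_right ℝ fun v => ?_
  rw [hinner v, gradient, toDual_symm_apply]

end Form

end Summit.QuantumFields.BalabanUV.T4Continuum.NE7b.StrongConvexSubgradientField

end
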